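import Summits.Parity.GeneralizedHardyLittlewood.Theorems.GreenTaoLevelTwoMNTwoRotationBohrSize

/-!
# Route `GreenTaoLevelTwo`, crux `MNTwo` (stmt-Parity-21276), line `birth`, stub `stub_mnVertical`:
# a Lipschitz partition of unity on the torus `(ℝ/ℤ)ᵏ` with small supports (GT 2008b §8)

Brick for block V3 (§8) of the `stub_mnVertical` census (B. Green, T. Tao, *Quadratic uniformity of
the Möbius function*, Ann. Inst. Fourier 58 (2008) = arXiv:math/0606087, §8: "take a partition of
unity `1 = ∑_α χ_α` on `G/Γ`, where each `χ_α` is supported on a ball of diameter at most `ρ₀/2`,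
… `‖χ_α‖_Lip ≪ ρ₀^{-1}`, the number of `χ_α` is `O(ρ₀^{-O(1)})`.  We leave the construction of such a
partition to the reader: modelling `G/Γ` by a torus, one may be quite explicit.").  Here is the
explicit construction for the torus `ℝᵏ/ℤᵏ` with the sup-distance, def-free: the one-dimensional
tents `τ_j(s) = max(0, 1 − m‖s − j/m‖_{ℝ/ℤ})`, `j < m`, and their tensor products
`χ_a(y) = ∏ᵢ τ_{aᵢ}(yᵢ)`, `a : Fin k → Fin m`:

* `tent_nonneg`, `tent_le_one`, `abs_tent_sub_tent_le` (`m`-Lipschitz for `‖·‖_{ℝ/ℤ}`),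
  `tent_support` (two points of the support are `< 2/m` apart in `ℝ/ℤ`), `sum_tent_eq_one` (`m ≥ 2`);
* `sum_prodTent_eq_one`, `abs_prodTent_le_one`, `abs_prodTent_sub_prodTent_le` (torus-Lipschitz
  constant `k·m`), `prodTent_support`.

References: [GreenTao2008QuadraticMobius] arXiv:math/0606087 §8.
-/

noncomputable section

open Finset Real

namespace Summit.Parity.GeneralizedHardyLittlewood.GreenTaoLevelTwoMNTwoTorusPartition

open Summit.Parity.GeneralizedHardyLittlewood.GreenTaoLevelTwoMNTwoRotationBohrSize (norm_coe_le_abs')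

/-! ### §1 One-dimensional tents -/

/-- `0 ≤ τ_j(s)`. [folklore] -/
theorem tent_nonneg (m j : ℕ) (s : ℝ) :
    0 ≤ max 0 (1 - (m : ℝ) * ‖((s - (j : ℝ) / m : ℝ) : AddCircle (1 : ℝ))‖) := le_max_left _ _

/-- `τ_j(s) ≤ 1`. [folklore] -/
theorem tent_le_one (m j : ℕ) (s : ℝ) :
    max 0 (1 - (m : ℝ) * ‖((s - (j : ℝ) / m : ℝ) : AddCircle (1 : ℝ))‖) ≤ 1 :=
by
  have h : 0 ≤ (m : ℝ) * ‖((s - (j : ℝ) / m : ℝ) : AddCircle (1 : ℝ))‖ := by positivity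
  exact max_le zero_le_one (by linarith)

/-- The tent `τ_j` is `m`-Lipschitz for the distance of `ℝ/ℤ`. [folklore] -/
theorem abs_tent_sub_tent_le (m j : ℕ) (s s' : ℝ) :
    |max 0 (1 - (m : ℝ) * ‖((s - (j : ℝ) / m : ℝ) : AddCircle (1 : ℝ))‖) -
        max 0 (1 - (m : ℝ) * ‖((s' - (j : ℝ) / m : ℝ) : AddCircle (1 : ℝ))‖)| ≤
      (m : ℝ) * ‖((s - s' : ℝ) : AddCircle (1 : ℝ))‖ := by
  have hm : (0 : ℝ) ≤ m := Nat.cast_nonneg m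
  refine (abs_max_sub_max_le_max _ _ _ _).trans ?_
  rw [sub_self, abs_zero]
  refine max_le (by positivity) ?_
  rw [show (1 : ℝ) - (m : ℝ) * ‖((s - (j : ℝ) / m : ℝ) : AddCircle (1 : ℝ))‖ -
      (1 - (m : ℝ) * ‖((s' - (j : ℝ) / m : ℝ) : AddCircle (1 : ℝ))‖) =
      -((m : ℝ) * (‖((s - (j : ℝ) / m : ℝ) : AddCircle (1 : ℝ))‖ -
        ‖((s' - (j : ℝ) / m : ℝ) : AddCircle (1 : ℝ))‖)) by ring, abs_neg, abs_mul,
    abs_of_nonneg hm]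
  refine mul_le_mul_of_nonneg_left ?_ hm
  refine (abs_norm_sub_norm_le _ _).trans ?_
  rw [← AddCircle.coe_sub, show (s - (j : ℝ) / m - (s' - (j : ℝ) / m) : ℝ) = s - s' by ring]

/-- Two points of the support of `τ_j` are `< 2/m` apart in `ℝ/ℤ`. [folklore] -/
theorem tent_support {m : ℕ} (hm : 0 < m) (j : ℕ) {s s' : ℝ}
    (hs : max 0 (1 - (m : ℝ) * ‖((s - (j : ℝ) / m : ℝ) : AddCircle (1 : ℝ))‖) ≠ 0)
    (hs' : max 0 (1 - (m : ℝ) * ‖((s' - (j : ℝ) / m : ℝ) : AddCircle (1 : ℝ))‖) ≠ 0) :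
    ‖((s - s' : ℝ) : AddCircle (1 : ℝ))‖ < 2 / m := by
  have hmr : (0 : ℝ) < m := by exact_mod_cast hm
  have h1 : ‖((s - (j : ℝ) / m : ℝ) : AddCircle (1 : ℝ))‖ < 1 / m := by
    by_contra hcon
    push Not at hcon
    apply hs
    apply max_eq_left
    have : 1 ≤ (m : ℝ) * ‖((s - (j : ℝ) / m : ℝ) : AddCircle (1 : ℝ))‖ := by
      rw [div_le_iff₀' hmr] at hcon; exact hcon
    linarith
  have h2 : ‖((s' - (j : ℝ) / m : ℝ) : AddCircle (1 : ℝ))‖ < 1 / m := by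
    by_contra hcon
    push Not at hcon
    apply hs'
    apply max_eq_left
    have : 1 ≤ (m : ℝ) * ‖((s' - (j : ℝ) / m : ℝ) : AddCircle (1 : ℝ))‖ := by
      rw [div_le_iff₀' hmr] at hcon; exact hcon
    linarith
  have h3 : ((s - s' : ℝ) : AddCircle (1 : ℝ)) =
      ((s - (j : ℝ) / m : ℝ) : AddCircle (1 : ℝ)) - ((s' - (j : ℝ) / m : ℝ) : AddCircle (1 : ℝ)) := by
    rw [← AddCircle.coe_sub]; congr 1; ring
  rw [h3]
  calc ‖((s - (j : ℝ) / m : ℝ) : AddCircle (1 : ℝ)) - ((s' - (j : ℝ) / m : ℝ) : AddCircle (1 : ℝ))‖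
      ≤ ‖((s - (j : ℝ) / m : ℝ) : AddCircle (1 : ℝ))‖ + ‖((s' - (j : ℝ) / m : ℝ) : AddCircle (1 : ℝ))‖ :=
        norm_sub_le _ _
    _ < 1 / m + 1 / m := add_lt_add h1 h2
    _ = 2 / m := by ring

/-- Two tents at `‖·‖_{ℝ/ℤ}`-distances `N₁ ≤ τ/m`, `N₂ ≤ (1−τ)/m` with `N₁ + N₂ ≥ 1/m` sum to `1`.
[folklore] -/
theorem two_tents_eq_one {m : ℝ} (hm : 0 < m) {N₁ N₂ τ : ℝ} (hτ0 : 0 ≤ τ) (hτ1 : τ ≤ 1)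
    (h1 : N₁ ≤ τ / m) (h2 : N₂ ≤ (1 - τ) / m) (h12 : 1 / m ≤ N₁ + N₂) :
    max 0 (1 - m * N₁) + max 0 (1 - m * N₂) = 1 := by
  have h1' : m * N₁ ≤ τ := by rw [le_div_iff₀ hm] at h1; linarith
  have h2' : m * N₂ ≤ 1 - τ := by rw [le_div_iff₀ hm] at h2; linarith
  have h12' : 1 ≤ m * N₁ + m * N₂ := by rw [div_le_iff₀' hm] at h12; linarith
  rw [max_eq_right (by linarith), max_eq_right (by linarith)]
  linarith

/-- The integer inequality behind the vanishing of the far tents: if `d ≤ m − 2`, `−(m−1) ≤ d`,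
`d ∉ {0, −1}`, `0 ≤ τ < 1`, then `|d + τ − mz| ≥ 1` for every integer `z`. [folklore] -/
theorem one_le_abs_far {m : ℕ} {d z : ℤ} {τ : ℝ} (hd1 : d ≤ (m : ℤ) - 2) (hd2 : -((m : ℤ) - 1) ≤ d)
    (hd0 : d ≠ 0) (hd3 : d ≠ -1) (hτ0 : 0 ≤ τ) (hτ1 : τ < 1) :
    1 ≤ |(d : ℝ) + τ - (m : ℝ) * z| := by
  have hd1r : (d : ℝ) ≤ (m : ℝ) - 2 := by exact_mod_cast hd1
  have hd2r : -((m : ℝ) - 1) ≤ d := by exact_mod_cast hd2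
  rcases le_or_gt 1 z with hz | hz
  · have hzr : (1 : ℝ) ≤ z := by exact_mod_cast hz
    have hm0 : (0 : ℝ) ≤ m := Nat.cast_nonneg m
    rw [le_abs]; right; nlinarith
  · rcases le_or_gt z (-1) with hz' | hz'
    · have hzr : (z : ℝ) ≤ -1 := by exact_mod_cast hz'
      have hm0 : (0 : ℝ) ≤ m := Nat.cast_nonneg m
      rw [le_abs]; left; nlinarith
    · have hz0 : z = 0 := by omega
      subst hz0
      simp only [Int.cast_zero, mul_zero, sub_zero]
      rcases le_or_gt 1 d with hd | hd
      · have : (1 : ℝ) ≤ d := by exact_mod_cast hd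
        rw [le_abs]; left; linarith
      · have : d ≤ -2 := by omega
        have : (d : ℝ) ≤ -2 := by exact_mod_cast this
        rw [le_abs]; right; linarith

/-- **The tents form a partition of unity on `ℝ/ℤ`**: `∑_{j<m} max(0, 1 − m‖s − j/m‖_{ℝ/ℤ}) = 1`
for `m ≥ 2`. [folklore] -/
theorem sum_tent_eq_one {m : ℕ} (hm : 2 ≤ m) (s : ℝ) :
    ∑ j ∈ range m, max 0 (1 - (m : ℝ) * ‖((s - (j : ℝ) / m : ℝ) : AddCircle (1 : ℝ))‖) = 1 := by
  have hm0 : 0 < m := by omega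
  have hmr : (0 : ℝ) < m := by exact_mod_cast hm0
  have hmr2 : (2 : ℝ) ≤ m := by exact_mod_cast hm
  have hnorm : ∀ u : ℝ, ‖((u : ℝ) : AddCircle (1 : ℝ))‖ = |u - round u| := fun u => by
    rw [AddCircle.norm_eq]; simp
  have hle : ∀ (u : ℝ) (z : ℤ), ‖((u : ℝ) : AddCircle (1 : ℝ))‖ ≤ |u - z| := fun u z => by
    rw [hnorm]; exact round_le u z
  have hge : ∀ (u c : ℝ), (∀ z : ℤ, c ≤ |u - z|) → c ≤ ‖((u : ℝ) : AddCircle (1 : ℝ))‖ :=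
    fun u c h => by rw [hnorm]; exact h (round u)
  have hshift : ∀ (u : ℝ) (z : ℤ), ‖((u + z : ℝ) : AddCircle (1 : ℝ))‖ =
      ‖((u : ℝ) : AddCircle (1 : ℝ))‖ := fun u z => by
    rw [hnorm, hnorm, round_add_intCast, Int.cast_add]; congr 1; ring
  -- reduce to `t = fract s ∈ [0,1)`
  set t : ℝ := Int.fract s with ht
  have ht0 : 0 ≤ t := Int.fract_nonneg s
  have ht1 : t < 1 := Int.fract_lt_one s
  have hst : ∀ j : ℕ, ‖((s - (j : ℝ) / m : ℝ) : AddCircle (1 : ℝ))‖ =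
      ‖((t - (j : ℝ) / m : ℝ) : AddCircle (1 : ℝ))‖ := by
    intro j
    rw [← hshift (t - (j : ℝ) / m) ⌊s⌋]
    congr 2
    rw [ht]; linarith [Int.fract_add_floor s]
  simp_rw [hst]
  -- `v = m t ∈ [0, m)`, `b₀ = ⌊v⌋`, `τ = v - b₀`
  set v : ℝ := (m : ℝ) * t with hv
  have hv0 : 0 ≤ v := by positivity
  have hvm : v < m := by rw [hv]; nlinarith
  set b₀ : ℕ := ⌊v⌋₊ with hb₀
  have hb₀le : (b₀ : ℝ) ≤ v := Nat.floor_le hv0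
  have hb₀lt : v < b₀ + 1 := Nat.lt_floor_add_one v
  have hb₀m : b₀ < m := by rw [hb₀]; exact (Nat.floor_lt hv0).2 hvm
  set τ : ℝ := v - b₀ with hτ
  have hτ0 : 0 ≤ τ := by rw [hτ]; linarith
  have hτ1 : τ < 1 := by rw [hτ]; linarith
  -- the tent at `j` in terms of `d = b₀ - j`: `m (t - j/m) = (b₀ - j) + τ`
  have hmu : ∀ j : ℕ, (m : ℝ) * (t - (j : ℝ) / m) = ((b₀ : ℤ) - j : ℤ) + τ := by
    intro j; push_cast; rw [hτ, hv]; field_simp; ring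
  -- far tents vanish
  have hfar : ∀ j : ℕ, j < m → ((b₀ : ℤ) - j ≠ 0) → ((b₀ : ℤ) - j ≠ -1) →
      ((b₀ : ℤ) - j ≤ (m : ℤ) - 2) →
      max 0 (1 - (m : ℝ) * ‖((t - (j : ℝ) / m : ℝ) : AddCircle (1 : ℝ))‖) = 0 := by
    intro j hj h0 h1 h2
    apply max_eq_left
    have hlow : 1 / (m : ℝ) ≤ ‖((t - (j : ℝ) / m : ℝ) : AddCircle (1 : ℝ))‖ := by
      apply hge
      intro z
      have h := one_le_abs_far (m := m) (z := z) h2 (by omega) h0 h1 hτ0 hτ1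
      have heq : (((b₀ : ℤ) - j : ℤ) : ℝ) + τ - (m : ℝ) * z = (m : ℝ) * (t - (j : ℝ) / m - z) := by
        rw [mul_sub, hmu]
      rw [heq, abs_mul, abs_of_pos hmr] at h
      rw [div_le_iff₀' hmr]; exact h
    have : 1 ≤ (m : ℝ) * ‖((t - (j : ℝ) / m : ℝ) : AddCircle (1 : ℝ))‖ := by
      rw [div_le_iff₀' hmr] at hlow; exact hlow
    linarith
  -- the tent at `b₀`: distance `≤ τ/m`
  have hN₁ : ‖((t - (b₀ : ℝ) / m : ℝ) : AddCircle (1 : ℝ))‖ ≤ τ / m := by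
    refine (hle _ 0).trans ?_
    rw [Int.cast_zero, sub_zero, show t - (b₀ : ℝ) / m = τ / m by
      rw [hτ, hv, sub_div, mul_div_cancel_left₀ t hmr.ne'], abs_of_nonneg (by positivity)]
  rcases Nat.lt_or_ge (b₀ + 1) m with hA | hB
  · -- Case A: `b₀ + 1 < m`; the two live tents are `b₀` and `b₀ + 1`
    have hN₂ : ‖((t - ((b₀ + 1 : ℕ) : ℝ) / m : ℝ) : AddCircle (1 : ℝ))‖ ≤ (1 - τ) / m := by
      refine (hle _ 0).trans ?_
      rw [Int.cast_zero, sub_zero, show t - ((b₀ + 1 : ℕ) : ℝ) / m = -((1 - τ) / m) by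
        push_cast; rw [hτ, hv]; field_simp; ring, abs_neg, abs_of_nonneg (by
          apply div_nonneg (by linarith) hmr.le)]
    have h12 : 1 / (m : ℝ) ≤ ‖((t - (b₀ : ℝ) / m : ℝ) : AddCircle (1 : ℝ))‖ +
        ‖((t - ((b₀ + 1 : ℕ) : ℝ) / m : ℝ) : AddCircle (1 : ℝ))‖ := by
      have hdiff : ((t - (b₀ : ℝ) / m : ℝ) : AddCircle (1 : ℝ)) -
          ((t - ((b₀ + 1 : ℕ) : ℝ) / m : ℝ) : AddCircle (1 : ℝ)) = (((1 : ℝ) / m : ℝ) : AddCircle (1 : ℝ)) := by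
        rw [← AddCircle.coe_sub]; congr 1; push_cast; field_simp; ring
      have hn : ‖(((1 : ℝ) / m : ℝ) : AddCircle (1 : ℝ))‖ = 1 / m := by
        rw [(AddCircle.norm_coe_eq_abs_iff (1 : ℝ) one_ne_zero).2, abs_of_pos (by positivity)]
        rw [abs_of_pos (by positivity : (0 : ℝ) < 1 / m), abs_one]
        exact one_div_le_one_div_of_le two_pos hmr2
      rw [← hn, ← hdiff]
      exact norm_sub_le _ _
    rw [sum_eq_add_of_mem (b₀) (b₀ + 1) (mem_range.2 hb₀m) (mem_range.2 hA) (by omega)]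
    · exact two_tents_eq_one hmr hτ0 hτ1.le hN₁ hN₂ h12
    · intro c hc hne
      have hcm := mem_range.1 hc
      refine hfar c hcm ?_ ?_ ?_
      · have := hne.1; omega
      · have := hne.2; omega
      · omega
  · -- Case B: `b₀ = m - 1`; the two live tents are `m - 1` and `0`
    have hb₀eq : b₀ + 1 = m := by omega
    have hN₂ : ‖((t - ((0 : ℕ) : ℝ) / m : ℝ) : AddCircle (1 : ℝ))‖ ≤ (1 - τ) / m := by
      refine (hle _ 1).trans ?_
      have hmb : (m : ℝ) = b₀ + 1 := by exact_mod_cast hb₀eq.symm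
      rw [Int.cast_one, show t - ((0 : ℕ) : ℝ) / m - 1 = -((1 - τ) / m) by
        push_cast; rw [hτ, hv]; field_simp; rw [hmb] at *; ring, abs_neg,
        abs_of_nonneg (by apply div_nonneg (by linarith) hmr.le)]
    have h12 : 1 / (m : ℝ) ≤ ‖((t - (b₀ : ℝ) / m : ℝ) : AddCircle (1 : ℝ))‖ +
        ‖((t - ((0 : ℕ) : ℝ) / m : ℝ) : AddCircle (1 : ℝ))‖ := by
      have hdiff : ((t - (b₀ : ℝ) / m : ℝ) : AddCircle (1 : ℝ)) -
          ((t - ((0 : ℕ) : ℝ) / m : ℝ) : AddCircle (1 : ℝ)) =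
          (((1 : ℝ) / m + ((-1 : ℤ) : ℝ) : ℝ) : AddCircle (1 : ℝ)) := by
        rw [← AddCircle.coe_sub]; congr 1
        have hmb : (m : ℝ) = b₀ + 1 := by exact_mod_cast hb₀eq.symm
        push_cast; field_simp; rw [hmb]; ring
      have hn : ‖(((1 : ℝ) / m + ((-1 : ℤ) : ℝ) : ℝ) : AddCircle (1 : ℝ))‖ = 1 / m := by
        rw [hshift]
        rw [(AddCircle.norm_coe_eq_abs_iff (1 : ℝ) one_ne_zero).2, abs_of_pos (by positivity)]
        rw [abs_of_pos (by positivity : (0 : ℝ) < 1 / m), abs_one]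
        exact one_div_le_one_div_of_le two_pos hmr2
      rw [← hn, ← hdiff]
      exact norm_sub_le _ _
    rw [sum_eq_add_of_mem (b₀) 0 (mem_range.2 hb₀m) (mem_range.2 hm0) (by omega)]
    · exact two_tents_eq_one hmr hτ0 hτ1.le hN₁ hN₂ h12
    · intro c hc hne
      have hcm := mem_range.1 hc
      refine hfar c hcm ?_ ?_ ?_
      · have := hne.1; omega
      · have := hne.2; omega
      · have := hne.2; omega

/-! ### §2 Tensor-product tents on `ℝᵏ/ℤᵏ` -/

/-- **Partition of unity on the torus `ℝᵏ/ℤᵏ`**: `∑_{a : Fin k → Fin m} ∏ᵢ τ_{aᵢ}(yᵢ) = 1` (`m ≥ 2`).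
[cite: GreenTao2008QuadraticMobius, §8 ("take a partition of unity … on `G/Γ`")] -/
theorem sum_prodTent_eq_one {m : ℕ} (hm : 2 ≤ m) (k : ℕ) (y : Fin k → ℝ) :
    ∑ a : Fin k → Fin m, ∏ i, max 0 (1 - (m : ℝ) *
      ‖((y i - ((a i : ℕ) : ℝ) / m : ℝ) : AddCircle (1 : ℝ))‖) = 1 := by
  have h := Finset.sum_prod_piFinset (Finset.univ : Finset (Fin m))
    (fun (i : Fin k) (j : Fin m) => max 0 (1 - (m : ℝ) *
      ‖((y i - ((j : ℕ) : ℝ) / m : ℝ) : AddCircle (1 : ℝ))‖))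
  rw [Fintype.piFinset_univ] at h
  rw [h]
  refine prod_eq_one fun i _ => ?_
  rw [Fin.sum_univ_eq_sum_range (fun j : ℕ => max 0 (1 - (m : ℝ) *
      ‖((y i - (j : ℝ) / m : ℝ) : AddCircle (1 : ℝ))‖)) m]
  exact sum_tent_eq_one hm (y i)

/-- `|∏ᵢ τ_{aᵢ}(yᵢ)| ≤ 1`. [folklore] -/
theorem abs_prodTent_le_one {m : ℕ} (k : ℕ) (a : Fin k → Fin m) (y : Fin k → ℝ) :
    |∏ i, max 0 (1 - (m : ℝ) * ‖((y i - ((a i : ℕ) : ℝ) / m : ℝ) : AddCircle (1 : ℝ))‖)| ≤ 1 := by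
  rw [abs_prod]
  exact prod_le_one (fun i _ => abs_nonneg _) fun i _ => by
    rw [abs_of_nonneg (tent_nonneg m (a i) (y i))]; exact tent_le_one m (a i) (y i)

/-- The product tents are torus-Lipschitz with constant `k·m`: if `‖yᵢ − y'ᵢ‖_{ℝ/ℤ} ≤ t` for all `i`
then `|χ_a(y) − χ_a(y')| ≤ k m t`. [folklore] -/
theorem abs_prodTent_sub_prodTent_le {m : ℕ} (k : ℕ) (a : Fin k → Fin m) (y y' : Fin k → ℝ)
    (t : ℝ) (ht : 0 ≤ t) (hyy : ∀ i, ‖((y i - y' i : ℝ) : AddCircle (1 : ℝ))‖ ≤ t) :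
    |∏ i, max 0 (1 - (m : ℝ) * ‖((y i - ((a i : ℕ) : ℝ) / m : ℝ) : AddCircle (1 : ℝ))‖) -
        ∏ i, max 0 (1 - (m : ℝ) * ‖((y' i - ((a i : ℕ) : ℝ) / m : ℝ) : AddCircle (1 : ℝ))‖)| ≤
      k * m * t := by
  classical
  set f : Fin k → ℝ := fun i => max 0 (1 - (m : ℝ) *
    ‖((y i - ((a i : ℕ) : ℝ) / m : ℝ) : AddCircle (1 : ℝ))‖) with hf
  set g : Fin k → ℝ := fun i => max 0 (1 - (m : ℝ) *
    ‖((y' i - ((a i : ℕ) : ℝ) / m : ℝ) : AddCircle (1 : ℝ))‖) with hg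
  have hf1 : ∀ i, |f i| ≤ 1 := fun i => by
    simp only [hf]; rw [abs_of_nonneg (tent_nonneg m (a i) (y i))]; exact tent_le_one m (a i) (y i)
  have hg1 : ∀ i, |g i| ≤ 1 := fun i => by
    simp only [hg]; rw [abs_of_nonneg (tent_nonneg m (a i) (y' i))]; exact tent_le_one m (a i) (y' i)
  have hfg : ∀ i, |f i - g i| ≤ m * t := fun i => by
    simp only [hf, hg]
    refine (abs_tent_sub_tent_le m (a i) (y i) (y' i)).trans ?_
    exact mul_le_mul_of_nonneg_left (hyy i) (Nat.cast_nonneg m)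
  have key : ∀ s : Finset (Fin k), |∏ i ∈ s, f i - ∏ i ∈ s, g i| ≤ #s * (m * t) := by
    intro s
    refine Finset.induction_on s (by simp) ?_
    intro b s hb ih
    rw [prod_insert hb, prod_insert hb, card_insert_of_notMem hb]
    have hpg : |∏ i ∈ s, g i| ≤ 1 := by
      rw [abs_prod]; exact prod_le_one (fun i _ => abs_nonneg _) fun i _ => hg1 i
    have hsplit : f b * ∏ i ∈ s, f i - g b * ∏ i ∈ s, g i =
        f b * (∏ i ∈ s, f i - ∏ i ∈ s, g i) + (f b - g b) * ∏ i ∈ s, g i := by ring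
    rw [hsplit]
    calc |f b * (∏ i ∈ s, f i - ∏ i ∈ s, g i) + (f b - g b) * ∏ i ∈ s, g i|
        ≤ |f b * (∏ i ∈ s, f i - ∏ i ∈ s, g i)| + |(f b - g b) * ∏ i ∈ s, g i| := abs_add_le _ _
      _ = |f b| * |∏ i ∈ s, f i - ∏ i ∈ s, g i| + |f b - g b| * |∏ i ∈ s, g i| := by
          rw [abs_mul, abs_mul]
      _ ≤ 1 * (#s * (m * t)) + m * t * 1 :=
          add_le_add (mul_le_mul (hf1 b) ih (abs_nonneg _) zero_le_one)
            (mul_le_mul (hfg b) hpg (abs_nonneg _) (by positivity))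
      _ = ((#s + 1 : ℕ) : ℝ) * (m * t) := by push_cast; ring
  have h := key Finset.univ
  rw [card_univ, Fintype.card_fin] at h
  calc |∏ i, f i - ∏ i, g i| ≤ k * (m * t) := h
    _ = k * m * t := by ring

/-- Supports of the product tents: two points where `χ_a ≠ 0` are coordinatewise `< 2/m` apart in
`ℝ/ℤ` (`m ≥ 1`). [folklore] -/
theorem prodTent_support {m : ℕ} (hm : 0 < m) (k : ℕ) (a : Fin k → Fin m) {y y' : Fin k → ℝ}
    (hy : ∏ i, max 0 (1 - (m : ℝ) * ‖((y i - ((a i : ℕ) : ℝ) / m : ℝ) : AddCircle (1 : ℝ))‖) ≠ 0)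
    (hy' : ∏ i, max 0 (1 - (m : ℝ) * ‖((y' i - ((a i : ℕ) : ℝ) / m : ℝ) : AddCircle (1 : ℝ))‖) ≠ 0)
    (i : Fin k) : ‖((y i - y' i : ℝ) : AddCircle (1 : ℝ))‖ < 2 / m := by
  rw [prod_ne_zero_iff] at hy hy'
  exact tent_support hm (a i) (hy i (mem_univ i)) (hy' i (mem_univ i))

end Summit.Parity.GeneralizedHardyLittlewood.GreenTaoLevelTwoMNTwoTorusPartition
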